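import Summits.RiemannHypothesis.RiemannHypothesis.Theorems.LiPrimeEchoDefs
import HarnessLib

/-!
# RiemannHypothesis / LiPrimeEcho — crux K2 `LiPrimeEdgeEcho`, part 1: the prime-power terms on the edge (RH-FREE)

RH-FREE [rh-li-prover].  Route `Theses/LiPrimeEcho.lean` (rung «Li PRIME-ECHO LAW» `LiTheory.LiZeroWindowEcho`), item
`LiPrimeEdgeEcho` (stmt-RiemannHypothesis-19245).  On the edge `w = 3/2 + iy` write `z = (w − 1)/w`, so that
`F_n(w) = zⁿ`, `F_n(1 − w) = z⁻ⁿ`, `|z| < 1`, `|z⁻ⁿ| ≤ e` for `y ≥ √n`, and `d/dy z^{±n} = ±n ζ z^{±n}` with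
`ζ = i/(w(w − 1))`, `Im ζ = (3/4 − y²)/Q`, `Q = (y² + 1/4)(y² + 9/4)`.  The term `Λ(m) m^{−w} z^{±n}` of `L(Λ, w) k_n(w)`
has logarithmic derivative `θ = −i log m ± n ζ` with `|Im θ| ≥ log m` (resp. `≥ log m − 1` for `m ≥ 3`, `y ≥ √n`), so one
integration by parts (`norm_integral_le_of_logDeriv`: `‖∫ E‖ ≤ 2M/D + (β − α) M B/D²` when `E' = Eθ`, `|θ| ≥ D`, `|E| ≤ M`,
`|θ'| ≤ B`) bounds every NON-RESONANT term by `O_c(Λ(m) m^{−3/2})` on windows `[T₁, T₂] ⊂ [√n, c√n + 1]`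
(van der Corput's first-derivative test, [Titchmarsh 1986, Lemma 4.3]).  The resonant term is `m = 2` against `z⁻ⁿ`
(`PrimeEdge.edgeTwo`).  Nothing here bears on the truth of RH.
-/

noncomputable section

-- D-0017: `Summit.<S>.<S>.…` is the designed namespace of a single-problem summit.
set_option linter.dupNamespace false

open Complex MeasureTheory intervalIntegral Set
open scoped Real Interval ArithmeticFunction.vonMangoldt

namespace Summit.RiemannHypothesis.RiemannHypothesis.Theorems.LiTheory

namespace PrimeEdge

/-! ### The edge point `w = 3/2 + iy` -/

/-- `Re w = 3/2`. -/
theorem liRightPt_re (y : ℝ) : (liRightPt y).re = 3 / 2 := by simp [liRightPt]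

/-- `Im w = y`. -/
theorem liRightPt_im (y : ℝ) : (liRightPt y).im = y := by simp [liRightPt]

/-- `w ≠ 0`. -/
theorem liRightPt_ne_zero (y : ℝ) : liRightPt y ≠ 0 := fun h ↦ by
  have := congrArg Complex.re h; rw [liRightPt_re] at this; norm_num at this

/-- `w − 1 ≠ 0`. -/
theorem liRightPt_sub_one_ne_zero (y : ℝ) : liRightPt y - 1 ≠ 0 := fun h ↦ by
  have := congrArg Complex.re h; rw [Complex.sub_re, liRightPt_re] at this; norm_num at this

/-- `1 − w ≠ 0`. -/
theorem one_sub_liRightPt_ne_zero (y : ℝ) : 1 - liRightPt y ≠ 0 := fun h ↦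
  liRightPt_sub_one_ne_zero y (by rw [← neg_sub, h, neg_zero])

/-- `dw/dy = i`. -/
theorem hasDerivAt_liRightPt (y : ℝ) : HasDerivAt liRightPt I y := by
  have h := ((hasDerivAt_id y).ofReal_comp.mul_const I).const_add (3 / 2 : ℂ)
  have e : liRightPt = fun y : ℝ ↦ (3 / 2 : ℂ) + ((id y : ℝ) : ℂ) * I := by funext y; simp [liRightPt]
  rw [e]
  simpa using h

/-- `w` is continuous in `y`. -/
theorem continuous_liRightPt : Continuous liRightPt := by unfold liRightPt; fun_prop

/-- `Q(y) = (y² + 1/4)(y² + 9/4) = |w(w − 1)|²`. -/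
def Qd (y : ℝ) : ℝ := (y ^ 2 + 1 / 4) * (y ^ 2 + 9 / 4)

/-- `Q > 0`. -/
theorem Qd_pos (y : ℝ) : 0 < Qd y := by unfold Qd; positivity

/-- `y⁴ ≤ Q`. -/
theorem pow_four_le_Qd (y : ℝ) : y ^ 4 ≤ Qd y := by unfold Qd; nlinarith [sq_nonneg y]

/-- `Re (w(w − 1)) = 3/4 − y²`. -/
theorem re_w_mul (y : ℝ) : (liRightPt y * (liRightPt y - 1)).re = 3 / 4 - y ^ 2 := by
  simp [liRightPt, sq]; ring

/-- `Im (w(w − 1)) = 2y`. -/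
theorem im_w_mul (y : ℝ) : (liRightPt y * (liRightPt y - 1)).im = 2 * y := by
  simp [liRightPt]; ring

/-- `|w(w − 1)|² = Q`. -/
theorem normSq_w_mul (y : ℝ) : Complex.normSq (liRightPt y * (liRightPt y - 1)) = Qd y := by
  rw [Complex.normSq_apply, re_w_mul, im_w_mul, Qd]; ring

/-- `‖w(w − 1)‖² = Q`. -/
theorem norm_w_mul_sq (y : ℝ) : ‖liRightPt y * (liRightPt y - 1)‖ ^ 2 = Qd y := by
  rw [← Complex.normSq_eq_norm_sq, normSq_w_mul]

/-- `‖w‖² = y² + 9/4`. -/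
theorem norm_liRightPt_sq (y : ℝ) : ‖liRightPt y‖ ^ 2 = y ^ 2 + 9 / 4 := by
  rw [← Complex.normSq_eq_norm_sq, Complex.normSq_apply]; simp [liRightPt, sq]; ring

/-- `‖w − 1‖² = y² + 1/4`. -/
theorem norm_liRightPt_sub_one_sq (y : ℝ) : ‖liRightPt y - 1‖ ^ 2 = y ^ 2 + 1 / 4 := by
  rw [← Complex.normSq_eq_norm_sq, Complex.normSq_apply]; simp [liRightPt, sq]; ring

/-! ### The ratio `z = (w − 1)/w` and the weights on the edge -/

/-- `z(y) = 1 − 1/w = (w − 1)/w`. -/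
def zq (y : ℝ) : ℂ := 1 - 1 / liRightPt y

/-- `z = (w − 1)/w`. -/
theorem zq_eq_div (y : ℝ) : zq y = (liRightPt y - 1) / liRightPt y := by
  unfold zq; field_simp [liRightPt_ne_zero y]

/-- `z ≠ 0`. -/
theorem zq_ne_zero (y : ℝ) : zq y ≠ 0 := by
  rw [zq_eq_div]; exact div_ne_zero (liRightPt_sub_one_ne_zero y) (liRightPt_ne_zero y)

/-- `F_n(w) = zⁿ`. -/
theorem liWeight_rightPt (n : ℕ) (y : ℝ) : liWeight n (liRightPt y) = zq y ^ n := rfl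

/-- `F_n(1 − w) = z⁻ⁿ`. -/
theorem liWeight_one_sub_rightPt (n : ℕ) (y : ℝ) : liWeight n (1 - liRightPt y) = (zq y ^ n)⁻¹ := by
  unfold liWeight
  rw [← inv_pow]
  congr 1
  rw [zq_eq_div, inv_div]
  have h1 := one_sub_liRightPt_ne_zero y
  have h2 := liRightPt_sub_one_ne_zero y
  field_simp
  ring

/-- `k_n(w) = zⁿ + z⁻ⁿ`. -/
theorem liSymWeight_rightPt (n : ℕ) (y : ℝ) : liSymWeight n (liRightPt y) = zq y ^ n + (zq y ^ n)⁻¹ := by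
  rw [liSymWeight, liWeight_rightPt, liWeight_one_sub_rightPt]

/-- `‖z‖² = (y² + 1/4)/(y² + 9/4)`. -/
theorem norm_zq_sq (y : ℝ) : ‖zq y‖ ^ 2 = (y ^ 2 + 1 / 4) / (y ^ 2 + 9 / 4) := by
  rw [zq_eq_div, norm_div, div_pow, norm_liRightPt_sq, norm_liRightPt_sub_one_sq]

/-- `‖z‖ ≤ 1`. -/
theorem norm_zq_le_one (y : ℝ) : ‖zq y‖ ≤ 1 := by
  rw [← sq_le_one_iff₀ (norm_nonneg _), norm_zq_sq, div_le_one (by positivity)]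
  linarith

/-- `‖zⁿ‖ ≤ 1`. -/
theorem norm_zq_pow_le_one (n : ℕ) (y : ℝ) : ‖zq y ^ n‖ ≤ 1 := by
  rw [norm_pow]; exact pow_le_one₀ (norm_nonneg _) (norm_zq_le_one y)

/-- `‖z⁻¹‖² = 1 + 2/(y² + 1/4)`. -/
theorem norm_zq_inv_sq (y : ℝ) : ‖(zq y)⁻¹‖ ^ 2 = 1 + 2 / (y ^ 2 + 1 / 4) := by
  rw [norm_inv, inv_pow, norm_zq_sq, inv_div]
  field_simp
  ring

/-- `‖z⁻ⁿ‖ ≤ e` for `y ≥ √n`. -/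
theorem norm_zq_pow_inv_le (n : ℕ) {y : ℝ} (hy : Real.sqrt n ≤ y) : ‖(zq y ^ n)⁻¹‖ ≤ Real.exp 1 := by
  have hy0 : 0 ≤ y := (Real.sqrt_nonneg _).trans hy
  have hyn : (n : ℝ) ≤ y ^ 2 := by
    have := Real.sq_sqrt (Nat.cast_nonneg n); nlinarith [Real.sqrt_nonneg (n : ℝ)]
  rw [← inv_pow, norm_pow]
  set a := ‖(zq y)⁻¹‖ with ha
  have ha0 : 0 ≤ a := norm_nonneg _
  set x : ℝ := 2 / (y ^ 2 + 1 / 4) with hx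
  have hx0 : 0 ≤ x := by positivity
  have h1 : a ^ 2 ≤ Real.exp x := by rw [norm_zq_inv_sq]; linarith [Real.add_one_le_exp x]
  have h2 : (a ^ n) ^ 2 ≤ Real.exp 1 ^ 2 := by
    rw [← pow_mul, mul_comm, pow_mul]
    refine (pow_le_pow_left₀ (sq_nonneg _) h1 n).trans ?_
    rw [← Real.exp_nat_mul, ← Real.exp_nat_mul]
    refine Real.exp_le_exp.2 ?_
    have hnx : (n : ℝ) * x ≤ 2 := by
      rw [hx, mul_div_assoc', div_le_iff₀ (by positivity)]
      nlinarith
    push_cast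
    linarith
  exact (pow_le_pow_iff_left₀ (pow_nonneg ha0 n) (Real.exp_pos 1).le two_ne_zero).1 h2

/-! ### The logarithmic derivative `ζ = i/(w(w − 1))` of `z` -/

/-- `ζ(y) = i/(w(w − 1))`. -/
def ld (y : ℝ) : ℂ := I / (liRightPt y * (liRightPt y - 1))

/-- `Im ζ = (3/4 − y²)/Q`. -/
theorem ld_im (y : ℝ) : (ld y).im = (3 / 4 - y ^ 2) / Qd y := by
  rw [ld, Complex.div_im, normSq_w_mul, re_w_mul, im_w_mul, Complex.I_re, Complex.I_im]
  ring

/-- For `y ≥ 1`: `Im ζ ≤ 0` and `−Im ζ ≤ 1/y²`. -/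
theorem ld_im_bounds {y : ℝ} (hy : 1 ≤ y) : (ld y).im ≤ 0 ∧ -(ld y).im ≤ 1 / y ^ 2 := by
  have hQ := Qd_pos y
  have hQ4 := pow_four_le_Qd y
  rw [ld_im]
  constructor
  · exact div_nonpos_of_nonpos_of_nonneg (by nlinarith) hQ.le
  · rw [← neg_div, neg_sub, div_le_div_iff₀ hQ (by positivity), one_mul]
    nlinarith

/-- `dz/dy = z ζ`. -/
theorem hasDerivAt_zq (y : ℝ) : HasDerivAt zq (zq y * ld y) y := by
  have h0 := liRightPt_ne_zero y
  have h1 := liRightPt_sub_one_ne_zero y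
  have h := ((hasDerivAt_const y (1 : ℂ)).div (hasDerivAt_liRightPt y) h0).const_sub (1 : ℂ)
  have key : HasDerivAt (fun x : ℝ ↦ (1 : ℂ) - 1 / liRightPt x) (zq y * ld y) y := by
    refine h.congr_deriv ?_
    rw [zq_eq_div, ld]
    field_simp
    ring
  exact key

/-- `d(zⁿ)/dy = zⁿ · nζ`. -/
theorem hasDerivAt_zq_pow (n : ℕ) (y : ℝ) : HasDerivAt (fun y ↦ zq y ^ n) (zq y ^ n * (n * ld y)) y := by
  refine ((hasDerivAt_zq y).pow n).congr_deriv ?_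
  rcases Nat.eq_zero_or_pos n with rfl | hn
  · simp
  · obtain ⟨k, rfl⟩ := Nat.exists_eq_add_of_le hn
    simp only [Nat.add_sub_cancel_left, pow_succ, pow_add]
    push_cast
    ring

/-- `d(z⁻ⁿ)/dy = z⁻ⁿ · (−nζ)`. -/
theorem hasDerivAt_zq_pow_inv (n : ℕ) (y : ℝ) :
    HasDerivAt (fun y ↦ (zq y ^ n)⁻¹) ((zq y ^ n)⁻¹ * (-(n * ld y))) y := by
  have h0 : zq y ^ n ≠ 0 := pow_ne_zero _ (zq_ne_zero y)
  refine ((hasDerivAt_zq_pow n y).inv h0).congr_deriv ?_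
  field_simp

/-- `ζ'(y) = (2w − 1)/(w(w − 1))²`. -/
def ld' (y : ℝ) : ℂ := (2 * liRightPt y - 1) / (liRightPt y * (liRightPt y - 1)) ^ 2

/-- `dζ/dy = ζ'`. -/
theorem hasDerivAt_ld (y : ℝ) : HasDerivAt ld (ld' y) y := by
  have h0 := liRightPt_ne_zero y
  have h1 := liRightPt_sub_one_ne_zero y
  have hp : HasDerivAt (fun y ↦ liRightPt y * (liRightPt y - 1)) (I * (liRightPt y - 1) + liRightPt y * I) y :=
    (hasDerivAt_liRightPt y).mul ((hasDerivAt_liRightPt y).sub_const 1)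
  have h := (hp.inv (mul_ne_zero h0 h1)).const_mul I
  have e : ld = fun y : ℝ ↦ I * (liRightPt y * (liRightPt y - 1))⁻¹ := by funext y; rw [ld, div_eq_mul_inv]
  rw [e]
  refine h.congr_deriv ?_
  rw [ld']
  field_simp
  rw [pow_two, Complex.I_mul_I]
  ring

/-- `ζ'` is continuous. -/
theorem continuous_ld' : Continuous ld' := by
  have hw := continuous_liRightPt
  unfold ld'
  exact ((continuous_const.mul hw).sub continuous_const).div ((hw.mul (hw.sub continuous_const)).pow 2)
    fun y ↦ pow_ne_zero _ (mul_ne_zero (liRightPt_ne_zero y) (liRightPt_sub_one_ne_zero y))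

/-- `‖ζ'‖ ≤ 3/y³` for `y ≥ 1`. -/
theorem norm_ld'_le {y : ℝ} (hy : 1 ≤ y) : ‖ld' y‖ ≤ 3 / y ^ 3 := by
  have hy0 : 0 < y := by linarith
  have hnum : ‖2 * liRightPt y - 1‖ ≤ 3 * y := by
    have hsq : ‖2 * liRightPt y - 1‖ ^ 2 = 4 + 4 * y ^ 2 := by
      rw [← Complex.normSq_eq_norm_sq, Complex.normSq_apply]; simp [liRightPt]; ring
    have : ‖2 * liRightPt y - 1‖ ^ 2 ≤ (3 * y) ^ 2 := by rw [hsq]; nlinarith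
    exact (pow_le_pow_iff_left₀ (norm_nonneg _) (by positivity) two_ne_zero).1 this
  have hQ := Qd_pos y
  have hQ4 := pow_four_le_Qd y
  rw [ld', norm_div, norm_pow, norm_w_mul_sq, div_le_div_iff₀ hQ (by positivity)]
  calc ‖2 * liRightPt y - 1‖ * y ^ 3 ≤ 3 * y * y ^ 3 := by gcongr
    _ = 3 * y ^ 4 := by ring
    _ ≤ 3 * Qd y := by linarith

/-! ### The Dirichlet factor `m^{−w}` -/

/-- `‖m^{−w}‖ = m^{−3/2}` (`m ≥ 1`). -/
theorem norm_cpow_neg_rightPt {m : ℕ} (hm : 0 < m) (y : ℝ) :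
    ‖(m : ℂ) ^ (-liRightPt y)‖ = (m : ℝ) ^ (-(3 / 2 : ℝ)) := by
  rw [Complex.norm_natCast_cpow_of_pos hm, Complex.neg_re, liRightPt_re]

/-- `m^{−w} ≠ 0` (`m ≥ 1`). -/
theorem cpow_neg_rightPt_ne_zero {m : ℕ} (hm : 0 < m) (y : ℝ) : (m : ℂ) ^ (-liRightPt y) ≠ 0 :=
  Complex.cpow_ne_zero_iff.2 (Or.inl (by exact_mod_cast hm.ne'))

/-- `d/dy m^{−w} = m^{−w} · (−i log m)`. -/
theorem hasDerivAt_cpow_neg_rightPt {m : ℕ} (hm : 0 < m) (y : ℝ) :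
    HasDerivAt (fun y ↦ (m : ℂ) ^ (-liRightPt y)) ((m : ℂ) ^ (-liRightPt y) * (-(Real.log m * I))) y := by
  have hm' : (m : ℂ) ≠ 0 := by exact_mod_cast hm.ne'
  have h : HasDerivAt (fun y : ℝ ↦ (m : ℂ) ^ (-liRightPt y)) ((m : ℂ) ^ (-liRightPt y) * Complex.log m * -I) y :=
    (Complex.hasStrictDerivAt_const_cpow (Or.inl hm')).hasDerivAt.comp y (hasDerivAt_liRightPt y).neg
  refine h.congr_deriv ?_
  rw [← Complex.natCast_log]
  ring

/-- `m^{−w}` is continuous in `y` (`m ≥ 1`). -/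
theorem continuous_cpow_neg_rightPt {m : ℕ} (hm : 0 < m) : Continuous fun y : ℝ ↦ (m : ℂ) ^ (-liRightPt y) :=
  continuous_liRightPt.neg.const_cpow (Or.inl (by exact_mod_cast hm.ne'))

end PrimeEdge

end Summit.RiemannHypothesis.RiemannHypothesis.Theorems.LiTheory
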